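import Summits.QuantumFields.YangMills.Theorems.UnitScaleTiltProp7NSIntertwinerOfRecord
import HarnessLib

/-!
# Route `UnitScaleTilt`, crux K1 «MinimiserStabilityRegPr» (stmt-QuantumFields-19200), EX positivity block — piece (a) of ★p1 g22's LOCATE-GAMMA-ROW §3:
# **THE ADJOINT INTERTWINER `D*_{U₀} ∘ Q_k† = Q″† ∘ D̄†` AT THE MEMBER**

Cell `ym3-torus` (HUMAN RULING D-0037, YM ladder rung R3 — continuum SU(2) YM₃ on T³; NOT d = 4, NOT infinite volume, NOT a mass gap, NOT the Clay problem),
width seat `ym-routeR-w3` gen 11, on ★★OWNER g32's assignment 2026-08-29T19:10:15Z «(a) adjoint intertwiner → routeR-w3 g11».  THEOREMS ONLY (0 `def`,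
0 `sorry`, default heartbeats); `--supports stmt-QuantumFields-19200 --as helper`; count-neutral.  BOOKKEEPING for the (X) mixing term of the γ-row
(LOCATE-GAMMA-ROW §1 (X): `⟪QAᵀ, QDμ⟫ = ⟪QAᵀ, D̄Q″μ⟫ = ⟪D̄†(QAᵀ), Q″μ⟫`), NOT a row of the face, NOT progress on EX.

WHAT.  The intertwiner of record (3.114)–(3.115) «`Q_kDλ = D_kQ′_kλ`» is in the tree for the averaging OF RECORD as ✓`Prop7NSIntertwinerOfRecord.exists_intertwiner_of_regPr`
(★px13 g9): linear maps `Q″ : L²(fine sites) → (coarse sites → M₂)` and `D′ : (coarse sites → M₂) → L²(coarse bonds)` with `Q_k ∘ D_{U₀} = D′ ∘ Q″`.  To take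
Hilbert adjoints the middle carrier must be an `L²` space: we DRESS it with the route's own transport ✓`toL2S F n cS` at the coarse member (`Site (F.P n) 0`,
weight `cS` — ANY positive weight; the consumer chooses) through the level identification ✓`T3LevelShift.siteShift (sites_eq F n K h) : Site (F.P n) 0 ≃ Site (F.P K) (K − n)`.
With `E : (Site (F.P K) (K − n) → M₂) ≃ₗ L²(coarse sites)` that equivalence (spelled out, no `def`), `Q₂ := E ∘ Q″`, `D₂ := D′ ∘ E⁻¹`:
  (§1) `Q_k ∘ D_{U₀} = D₂ ∘ Q₂` as linear maps (✓`hint` read through `E⁻¹E = 1`);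
  (§2) ★ `D*_{U₀} ∘ Q_k† = Q₂† ∘ D₂†` — `LinearMap.adjoint` of §1, `(AB)† = B†A†`, and print's «`D*` is the adjoint of `D`» as the tree theorem ✓`adjoint_DL2`;
  (§3) ★ the (X)-shaped reading `⟪Q_kA, Q_k(D_{U₀}μ)⟫ = ⟪D₂†(Q_kA), Q₂μ⟫` for every fine one-form `A` and gauge parameter `μ`;
  (§4) the member corollary under `RegPr` (`10¹²L³ε₀ ≤ 1`): §2–§3 hold for SOME `(Q″, D′)` carrying ✓`exists_intertwiner_of_regPr`'s `hint` and `ker Q″ ≤ N_S` rows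
       (consumers needing the top-mean rows `htop`∕`hex` too should `obtain` from ★px13's theorem and apply §2–§3 to the same witnesses — the generic form is the API).
[cite: Balaban1985BackgroundPropagators, (3.114)-(3.115) p.418, (3.8) p.392, (3.16) p.393]
-/

set_option autoImplicit false

noncomputable section

open scoped BigOperators Matrix.Norms.L2Operator InnerProductSpace

namespace Summit.QuantumFields.YangMills.Theorems.Prop7AdjointIntertwiner

open Literature.MathematicalPhysics.QuantumFieldTheory.Balaban1983to89
open Literature.MathematicalPhysics.QuantumFieldTheory.Balaban1983to89.T3ContinuumYM3Torus
open B9Eq311L2Pairing (WL2)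
open B11Eq103H1Complex (SiteL2K BondL2K)
open T3PrintedRegularMinimiser (RegPr)
open T3PrintedRegularOrbits (sites_eq)
open T3LevelShift (siteShift)
open Summit.QuantumFields.YangMills.Theorems.Prop7SectET3Transport (periodsT3)
open Summit.QuantumFields.YangMills.Theorems.Prop7SectET3HilbertLetters (W₂ toL2 toL2S toL2B QL2 DL2 DstarL2 adjoint_DL2)
open Summit.QuantumFields.YangMills.Theorems.Prop7SectET3GaugeProjector (NS)
open Summit.QuantumFields.YangMills.Theorems.Prop7NSIntertwinerOfRecord (exists_intertwiner_of_regPr)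

variable (F : T3Family) {n K : ℕ}

/-! ## §1 The intertwining relation with the coarse site carrier dressed as an `L²` space -/

/-- **(3.115) WITH THE MIDDLE CARRIER DRESSED**: if `Q_k(D_{U₀}λ) = D′(Q″λ)` for every `λ`, then `Q_k ∘ D_{U₀} = (D′ ∘ E⁻¹) ∘ (E ∘ Q″)` as linear maps, for the
`L²` dressing `E = toL2S F n cS ∘ (· ∘ siteShift (sites_eq F n K h))` of the coarse site functions (any weight `cS`). [cite: Balaban1985BackgroundPropagators, (3.115) p.418] -/
theorem QL2_comp_DL2_eq_dressed (h : n ≤ K) (c₀ cB cS : ℝ) [Fact (0 < c₀)] (U₀ : GaugeField (F.P K) 0 (Matrix.specialUnitaryGroup (Fin 2) ℂ))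
    (Q'' : SiteL2K ℂ 3 (periodsT3 F K) c₀ W₂ →ₗ[ℂ] (Site (F.P K) (K - n) → Matrix (Fin 2) (Fin 2) ℂ))
    (D' : (Site (F.P K) (K - n) → Matrix (Fin 2) (Fin 2) ℂ) →ₗ[ℂ] WL2 ℂ (fun _ : PBond (F.P n) 0 => cB) W₂)
    (hint : ∀ l, QL2 F n K h c₀ cB U₀ (DL2 F n K c₀ U₀ l) = D' (Q'' l)) :
    QL2 F n K h c₀ cB U₀ ∘ₗ DL2 F n K c₀ U₀ =
      (D' ∘ₗ ((LinearEquiv.funCongrLeft ℂ (Matrix (Fin 2) (Fin 2) ℂ) (siteShift (sites_eq F n K h))).symm.toLinearMap ∘ₗ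
          (toL2S F n cS).symm.toLinearMap)) ∘ₗ
        ((toL2S F n cS).toLinearMap ∘ₗ (LinearEquiv.funCongrLeft ℂ (Matrix (Fin 2) (Fin 2) ℂ) (siteShift (sites_eq F n K h))).toLinearMap ∘ₗ Q'') := by
  apply LinearMap.ext
  intro l
  show QL2 F n K h c₀ cB U₀ (DL2 F n K c₀ U₀ l) =
    D' ((LinearEquiv.funCongrLeft ℂ (Matrix (Fin 2) (Fin 2) ℂ) (siteShift (sites_eq F n K h))).symm
      ((toL2S F n cS).symm ((toL2S F n cS) ((LinearEquiv.funCongrLeft ℂ (Matrix (Fin 2) (Fin 2) ℂ) (siteShift (sites_eq F n K h))) (Q'' l)))))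
  rw [LinearEquiv.symm_apply_apply, LinearEquiv.symm_apply_apply]
  exact hint l

/-! ## §2 ★ The adjoint intertwiner -/

/-- ★ **THE ADJOINT INTERTWINER `D*_{U₀} ∘ Q_k† = Q₂† ∘ D₂†`** (`Q₂ = E ∘ Q″`, `D₂ = D′ ∘ E⁻¹`): the Hilbert adjoint of (3.115) for the averaging of record, with print's
«`D*` is the adjoint of `D`» (✓`adjoint_DL2`) — for ANY pair `(Q″, D′)` intertwining `Q_k ∘ D_{U₀}`, any background `U₀`, any positive weights.
[cite: Balaban1985BackgroundPropagators, (3.115) p.418, (3.8) p.392] -/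
theorem DstarL2_comp_adjoint_QL2_eq (h : n ≤ K) (c₀ cB cS : ℝ) [Fact (0 < c₀)] [Fact (0 < cB)] [Fact (0 < cS)]
    (U₀ : GaugeField (F.P K) 0 (Matrix.specialUnitaryGroup (Fin 2) ℂ))
    (Q'' : SiteL2K ℂ 3 (periodsT3 F K) c₀ W₂ →ₗ[ℂ] (Site (F.P K) (K - n) → Matrix (Fin 2) (Fin 2) ℂ))
    (D' : (Site (F.P K) (K - n) → Matrix (Fin 2) (Fin 2) ℂ) →ₗ[ℂ] WL2 ℂ (fun _ : PBond (F.P n) 0 => cB) W₂)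
    (hint : ∀ l, QL2 F n K h c₀ cB U₀ (DL2 F n K c₀ U₀ l) = D' (Q'' l)) :
    DstarL2 F n K c₀ U₀ ∘ₗ LinearMap.adjoint (QL2 F n K h c₀ cB U₀) =
      LinearMap.adjoint ((toL2S F n cS).toLinearMap ∘ₗ
          (LinearEquiv.funCongrLeft ℂ (Matrix (Fin 2) (Fin 2) ℂ) (siteShift (sites_eq F n K h))).toLinearMap ∘ₗ Q'') ∘ₗ
        LinearMap.adjoint (D' ∘ₗ ((LinearEquiv.funCongrLeft ℂ (Matrix (Fin 2) (Fin 2) ℂ) (siteShift (sites_eq F n K h))).symm.toLinearMap ∘ₗ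
          (toL2S F n cS).symm.toLinearMap)) := by
  rw [← adjoint_DL2, ← LinearMap.adjoint_comp, QL2_comp_DL2_eq_dressed F h c₀ cB cS U₀ Q'' D' hint, LinearMap.adjoint_comp]

/-- The same, APPLIED: `D*_{U₀}(Q_k† Y) = Q₂†(D₂† Y)` for every coarse one-form `Y`. [cite: Balaban1985BackgroundPropagators, (3.115) p.418, (3.8) p.392] -/
theorem DstarL2_adjoint_QL2_apply (h : n ≤ K) (c₀ cB cS : ℝ) [Fact (0 < c₀)] [Fact (0 < cB)] [Fact (0 < cS)]
    (U₀ : GaugeField (F.P K) 0 (Matrix.specialUnitaryGroup (Fin 2) ℂ))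
    (Q'' : SiteL2K ℂ 3 (periodsT3 F K) c₀ W₂ →ₗ[ℂ] (Site (F.P K) (K - n) → Matrix (Fin 2) (Fin 2) ℂ))
    (D' : (Site (F.P K) (K - n) → Matrix (Fin 2) (Fin 2) ℂ) →ₗ[ℂ] WL2 ℂ (fun _ : PBond (F.P n) 0 => cB) W₂)
    (hint : ∀ l, QL2 F n K h c₀ cB U₀ (DL2 F n K c₀ U₀ l) = D' (Q'' l)) (Y : WL2 ℂ (fun _ : PBond (F.P n) 0 => cB) W₂) :
    DstarL2 F n K c₀ U₀ (LinearMap.adjoint (QL2 F n K h c₀ cB U₀) Y) =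
      LinearMap.adjoint ((toL2S F n cS).toLinearMap ∘ₗ
          (LinearEquiv.funCongrLeft ℂ (Matrix (Fin 2) (Fin 2) ℂ) (siteShift (sites_eq F n K h))).toLinearMap ∘ₗ Q'')
        (LinearMap.adjoint (D' ∘ₗ ((LinearEquiv.funCongrLeft ℂ (Matrix (Fin 2) (Fin 2) ℂ) (siteShift (sites_eq F n K h))).symm.toLinearMap ∘ₗ
          (toL2S F n cS).symm.toLinearMap)) Y) := by
  have h2 := congrArg (fun T => T Y) (DstarL2_comp_adjoint_QL2_eq F h c₀ cB cS U₀ Q'' D' hint)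
  simpa only [LinearMap.coe_comp, Function.comp_apply] using h2

/-! ## §3 ★ The (X)-shaped reading: moving `D̄` across the coarse inner product -/

/-- ★ **`⟪Q_kA, Q_k(D_{U₀}μ)⟫ = ⟪D₂†(Q_kA), Q₂μ⟫`** — the mixing term of the γ-row's Schur split (LOCATE-GAMMA-ROW §1 (X)) with `D̄` moved onto the first factor:
`Q_k(D_{U₀}μ) = D₂(Q₂μ)` (§1) and `⟪v, D₂w⟫ = ⟪D₂†v, w⟫`. [cite: Balaban1985BackgroundPropagators, (3.115) p.418, (3.16) p.393] -/
theorem inner_QL2_QL2_DL2_eq (h : n ≤ K) (c₀ cB cS : ℝ) [Fact (0 < c₀)] [Fact (0 < cB)] [Fact (0 < cS)]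
    (U₀ : GaugeField (F.P K) 0 (Matrix.specialUnitaryGroup (Fin 2) ℂ))
    (Q'' : SiteL2K ℂ 3 (periodsT3 F K) c₀ W₂ →ₗ[ℂ] (Site (F.P K) (K - n) → Matrix (Fin 2) (Fin 2) ℂ))
    (D' : (Site (F.P K) (K - n) → Matrix (Fin 2) (Fin 2) ℂ) →ₗ[ℂ] WL2 ℂ (fun _ : PBond (F.P n) 0 => cB) W₂)
    (hint : ∀ l, QL2 F n K h c₀ cB U₀ (DL2 F n K c₀ U₀ l) = D' (Q'' l))
    (A : BondL2K ℂ 3 (periodsT3 F K) c₀ W₂) (μ : SiteL2K ℂ 3 (periodsT3 F K) c₀ W₂) :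
    ⟪QL2 F n K h c₀ cB U₀ A, QL2 F n K h c₀ cB U₀ (DL2 F n K c₀ U₀ μ)⟫_ℂ =
      ⟪LinearMap.adjoint (D' ∘ₗ ((LinearEquiv.funCongrLeft ℂ (Matrix (Fin 2) (Fin 2) ℂ) (siteShift (sites_eq F n K h))).symm.toLinearMap ∘ₗ
            (toL2S F n cS).symm.toLinearMap)) (QL2 F n K h c₀ cB U₀ A),
        ((toL2S F n cS).toLinearMap ∘ₗ (LinearEquiv.funCongrLeft ℂ (Matrix (Fin 2) (Fin 2) ℂ) (siteShift (sites_eq F n K h))).toLinearMap ∘ₗ Q'') μ⟫_ℂ := by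
  rw [LinearMap.adjoint_inner_left]
  congr 1
  exact LinearMap.congr_fun (QL2_comp_DL2_eq_dressed F h c₀ cB cS U₀ Q'' D' hint) μ

/-- The general adjoint move for the dressed pair: `⟪v, Q_k(D_{U₀}μ)⟫ = ⟪D₂†v, Q₂μ⟫` for every coarse one-form `v`. [cite: Balaban1985BackgroundPropagators, (3.115) p.418, (3.16) p.393] -/
theorem inner_QL2_DL2_eq (h : n ≤ K) (c₀ cB cS : ℝ) [Fact (0 < c₀)] [Fact (0 < cB)] [Fact (0 < cS)]
    (U₀ : GaugeField (F.P K) 0 (Matrix.specialUnitaryGroup (Fin 2) ℂ))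
    (Q'' : SiteL2K ℂ 3 (periodsT3 F K) c₀ W₂ →ₗ[ℂ] (Site (F.P K) (K - n) → Matrix (Fin 2) (Fin 2) ℂ))
    (D' : (Site (F.P K) (K - n) → Matrix (Fin 2) (Fin 2) ℂ) →ₗ[ℂ] WL2 ℂ (fun _ : PBond (F.P n) 0 => cB) W₂)
    (hint : ∀ l, QL2 F n K h c₀ cB U₀ (DL2 F n K c₀ U₀ l) = D' (Q'' l))
    (v : WL2 ℂ (fun _ : PBond (F.P n) 0 => cB) W₂) (μ : SiteL2K ℂ 3 (periodsT3 F K) c₀ W₂) :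
    ⟪v, QL2 F n K h c₀ cB U₀ (DL2 F n K c₀ U₀ μ)⟫_ℂ =
      ⟪LinearMap.adjoint (D' ∘ₗ ((LinearEquiv.funCongrLeft ℂ (Matrix (Fin 2) (Fin 2) ℂ) (siteShift (sites_eq F n K h))).symm.toLinearMap ∘ₗ
            (toL2S F n cS).symm.toLinearMap)) v,
        ((toL2S F n cS).toLinearMap ∘ₗ (LinearEquiv.funCongrLeft ℂ (Matrix (Fin 2) (Fin 2) ℂ) (siteShift (sites_eq F n K h))).toLinearMap ∘ₗ Q'') μ⟫_ℂ := by
  rw [LinearMap.adjoint_inner_left]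
  congr 1
  exact LinearMap.congr_fun (QL2_comp_DL2_eq_dressed F h c₀ cB cS U₀ Q'' D' hint) μ

/-! ## §4 The member corollary under `RegPr` -/

/-- **AT A REGULAR MEMBER (`U₀ ∈ RegPr ε₀`, `10¹²L³ε₀ ≤ 1`) THE ADJOINT INTERTWINER HOLDS FOR THE AVERAGING OF RECORD**: some `(Q″, D′)` with
`Q_k ∘ D_{U₀} = D′ ∘ Q″` and `ker Q″ ≤ N_S(U₀)` (★px13 g9's ✓`exists_intertwiner_of_regPr`, its top-mean rows dropped here) satisfies
`D*_{U₀} ∘ Q_k† = Q₂† ∘ D₂†` for the `cS`-dressing. [cite: Balaban1985BackgroundPropagators, (3.114)-(3.115) p.418, (3.8) p.392] -/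
theorem exists_adjoint_intertwiner_of_regPr (h : n ≤ K) {c₀ : ℝ} [Fact (0 < c₀)] (cB cS : ℝ) [Fact (0 < cB)] [Fact (0 < cS)] {ε₀ : ℝ} (hε₀ : 0 < ε₀)
    (hWε : 10 ^ 12 * (F.L : ℝ) ^ 3 * ε₀ ≤ 1) (U₀ : GaugeField (F.P K) 0 (Matrix.specialUnitaryGroup (Fin 2) ℂ)) (hreg : RegPr F n K ε₀ U₀) :
    ∃ (Q'' : SiteL2K ℂ 3 (periodsT3 F K) c₀ W₂ →ₗ[ℂ] (Site (F.P K) (K - n) → Matrix (Fin 2) (Fin 2) ℂ))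
      (D' : (Site (F.P K) (K - n) → Matrix (Fin 2) (Fin 2) ℂ) →ₗ[ℂ] WL2 ℂ (fun _ : PBond (F.P n) 0 => cB) W₂),
      (∀ l, QL2 F n K h c₀ cB U₀ (DL2 F n K c₀ U₀ l) = D' (Q'' l)) ∧ LinearMap.ker Q'' ≤ NS F n K h c₀ cB U₀ ∧
      DstarL2 F n K c₀ U₀ ∘ₗ LinearMap.adjoint (QL2 F n K h c₀ cB U₀) =
        LinearMap.adjoint ((toL2S F n cS).toLinearMap ∘ₗ
            (LinearEquiv.funCongrLeft ℂ (Matrix (Fin 2) (Fin 2) ℂ) (siteShift (sites_eq F n K h))).toLinearMap ∘ₗ Q'') ∘ₗ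
          LinearMap.adjoint (D' ∘ₗ ((LinearEquiv.funCongrLeft ℂ (Matrix (Fin 2) (Fin 2) ℂ) (siteShift (sites_eq F n K h))).symm.toLinearMap ∘ₗ
            (toL2S F n cS).symm.toLinearMap)) := by
  obtain ⟨Q'', D', hint, _, _, _, hker⟩ := exists_intertwiner_of_regPr F h (c₀ := c₀) cB hε₀ hWε U₀ hreg
  exact ⟨Q'', D', hint, hker, DstarL2_comp_adjoint_QL2_eq F h c₀ cB cS U₀ Q'' D' hint⟩

end Summit.QuantumFields.YangMills.Theorems.Prop7AdjointIntertwiner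

end
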